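import Summits.Ventures.LatticeQCDFlow.Scoring.OnePlaquetteSU3HaarBridge
import Summits.Ventures.LatticeQCDFlow.Scaling.PlaquetteIndependence2D
import Literature.RepresentationTheory.CompactGroups.UnitaryTrick
import HarnessLib

/-!
# The free energy density of two-dimensional lattice gauge theory on the torus is `log z₁(β)`; for `SU(3)` (given Weyl's formula) it is `−3β + log Σ_q det[I_{|q+i−j|}(β)]`

HONEST FRAMING: exact (Metropolis-corrected) sampling algorithms for lattice gauge theory;
figures of merit are autocorrelation/cost numbers at stated couplings and volumes; no
continuum-physics claim.

Venture `LatticeQCDFlow` (cell pub-lqcd), sub-topic `Scoring`; FANOUT row 5 (`s0-sun-a`), GEN-16.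
NEW WORK of the cell (placement rule).  GEN-12's `SU2TorusFreeEnergy.lean` typed the 2-d SU(2) torus
free energy and its density from the EXACT character formula.  For a general compact group the tree's
`Scaling/PlaquetteIndependence2D.lean` (row 30: off one puncture the plaquettes of `(ℤ/L)²` are
independent Haar variables) gives the sandwich `e^{−βs} z₁^{L²−1} ≤ Z_{(ℤ/L)²} ≤ z₁^{L²−1}` in
`ℝ≥0∞`; here it is turned into real-number statements and a limit, and specialised to `SU(3)` with
GEN-16's conditional Haar bridge (`OnePlaquetteSU3HaarBridge.z1_su3_eq_tsum_det`):

* §1 (ANY compact second-countable `G`, continuous `ρ` with plaquette actions in `[0, s]`, `β ≥ 0`):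
  `ofReal_exp_neg_le_z1` (`z₁ ≥ e^{−βs}`), `partitionFunction_two_toReal_mem`
  (`e^{−βs} z₁^{L²−1} ≤ Z ≤ z₁^{L²−1}`, `0 < z₁ ≤ 1` in `ℝ`), `log_partitionFunction_two_mem`
  (`(L²−1) log z₁ − βs ≤ log Z ≤ (L²−1) log z₁`) and
  **`tendsto_log_partitionFunction_two_div_sq`** — THE FREE ENERGY DENSITY EXISTS AND IS `log z₁(β)`:
  `log Z_{(ℤ/(L+2))²}(β)/(L+2)² → log z₁(β)`;
* §2 (`SU(3)`, fundamental representation; `|Re tr U| ≤ 3` from the tree's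
  `CompactGroup.abs_re_trace_le_card`, so `s = 6`): `tsum_det_besselI_pos` (`Σ_q det[I_{|q+i−j|}(β)] > 0`,
  unconditional: it is `Z₃(3β)/(6(2π)²)`), and CONDITIONALLY on the named fact
  `hW : weylIntegralFormula_specialUnitary (Fin 3)` (Bröcker–tom Dieck IV (1.11)): `z1_su3_toReal`
  (`z₁(β) = e^{−3β} Σ_q det[I_{|q+i−j|}(β)]` as a positive real), **`log_partitionFunction_su3_two_mem`** —
  `(L²−1)F(β) − 6β ≤ log Z^{SU(3)}_{(ℤ/L)²}(β) ≤ (L²−1)F(β)` with `F(β) = −3β + log Σ_q det[I_{|q+i−j|}(β)]`,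
  and **`tendsto_log_partitionFunction_su3_two_div_sq`** — THE 2-d SU(3) FREE ENERGY DENSITY IS `F(β)`.

Dictionary: theory-2's `β` is the table's `β_table/3` (`e^{−β(3 − Re tr U)} = e^{−3β} e^{(β_table/3) Re tr U}`);
`F(β) + 3β = log Σ_q det[I_{|q+i−j|}(β)]` is the table-normalised free energy per plaquette of the
infinite 2-d SU(3) lattice.  NOT here: the `O(1)` term exactly (for SU(2) it is exponentially small in
`L²`, GEN-12; for SU(3) that needs the character expansion on the Haar side), `β < 0`.  Nothing is cited
as a fact beyond `hW`; no `def`.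
-/

noncomputable section

open Real MeasureTheory Filter Topology
open Literature.MathematicalPhysics.QuantumFieldTheory Literature.MathematicalPhysics.QuantumLattice
open Literature.Analysis.FunctionSpaces (besselI)
open Literature.RepresentationTheory.CompactGroups
open Summit.Ventures.LatticeQCDFlow.Theory2.Lattice
open Summit.Ventures.LatticeQCDFlow.Theory2.Lattice.TwoDim

namespace Summit.Ventures.LatticeQCDFlow.Scoring

/-! ### 1. Any compact group: the 2-d torus free energy is `(L² − 1) log z₁ + O(1)` -/

section General

variable {N : ℕ} {G : Type*} [Group G] [TopologicalSpace G] [IsTopologicalGroup G] [CompactSpace G]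
  [SecondCountableTopology G] [MeasurableSpace G] [BorelSpace G] (ρ : G →* Matrix (Fin N) (Fin N) ℂ)

omit [SecondCountableTopology G] in
/-- `z₁(β) ≥ e^{−βs}` when every plaquette action `N − Re tr ρ(g)` is at most `s` and `β ≥ 0`. -/
theorem ofReal_exp_neg_le_z1 {β s : ℝ} (hs : ∀ g, (N : ℝ) - (ρ g).trace.re ≤ s) (hβ : 0 ≤ β) :
    ENNReal.ofReal (Real.exp (-(β * s))) ≤ z1 ρ β := by
  unfold z1
  calc ENNReal.ofReal (Real.exp (-(β * s)))
      = ∫⁻ _, ENNReal.ofReal (Real.exp (-(β * s))) ∂(haarProbability G) := by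
        rw [lintegral_const, measure_univ, mul_one]
    _ ≤ _ := lintegral_mono fun g => ENNReal.ofReal_le_ofReal
        (Real.exp_le_exp.mpr (neg_le_neg (mul_le_mul_of_nonneg_left (hs g) hβ)))

/-- **The two-dimensional free energy sandwich in real numbers.**  On `(ℤ/L)²`, `L ≥ 2`, for a
continuous
representation with plaquette actions in `[0, s]` and `β ≥ 0`:
`e^{−βs} z₁(β)^{L²−1} ≤ Z_{(ℤ/L)²}(β) ≤ z₁(β)^{L²−1}` and `0 < z₁(β) ≤ 1`
(`Scaling/PlaquetteIndependence2D`: the plaquettes off one puncture are independent Haar variables). -/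
theorem partitionFunction_two_toReal_mem {L : ℕ} [NeZero L] (hL : 2 ≤ L)
    (hρ : Continuous (ρ : G → Matrix (Fin N) (Fin N) ℂ)) (htr : ∀ g, (ρ g).trace.re ≤ N)
    {β s : ℝ} (hs : ∀ g, (N : ℝ) - (ρ g).trace.re ≤ s) (hβ : 0 ≤ β) :
    Real.exp (-(β * s)) * (z1 ρ β).toReal ^ (L ^ 2 - 1)
        ≤ (partitionFunction (d := 2) (L := L) ρ β).toReal ∧
      (partitionFunction (d := 2) (L := L) ρ β).toReal ≤ (z1 ρ β).toReal ^ (L ^ 2 - 1) ∧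
      0 < (z1 ρ β).toReal ∧ (z1 ρ β).toReal ≤ 1 := by
  have hz1 : z1 ρ β ≤ 1 := z1_le_one ρ htr hβ
  have hz_ne : z1 ρ β ≠ ⊤ := ne_top_of_le_ne_top ENNReal.one_ne_top hz1
  have hup := partitionFunction_two_le ρ hL hρ htr hβ
  have hlo := le_partitionFunction_two ρ hL hρ hs hβ
  have hpow_ne : z1 ρ β ^ (L ^ 2 - 1) ≠ ⊤ := ENNReal.pow_ne_top hz_ne
  have hZ_ne : partitionFunction (d := 2) (L := L) ρ β ≠ ⊤ := ne_top_of_le_ne_top hpow_ne hup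
  refine ⟨?_, ?_, ?_, ?_⟩
  · have h := ENNReal.toReal_mono hZ_ne hlo
    rwa [ENNReal.toReal_mul, ENNReal.toReal_ofReal (Real.exp_pos _).le, ENNReal.toReal_pow] at h
  · have h := ENNReal.toReal_mono hpow_ne hup
    rwa [ENNReal.toReal_pow] at h
  · have h := ENNReal.toReal_mono hz_ne (ofReal_exp_neg_le_z1 ρ hs hβ)
    rw [ENNReal.toReal_ofReal (Real.exp_pos _).le] at h
    exact lt_of_lt_of_le (Real.exp_pos _) h
  · have h := ENNReal.toReal_mono ENNReal.one_ne_top hz1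
    rwa [ENNReal.toReal_one] at h

/-- **The free energy is extensive up to one plaquette**:
`(L² − 1) log z₁(β) − βs ≤ log Z_{(ℤ/L)²}(β) ≤ (L² − 1) log z₁(β)`. -/
theorem log_partitionFunction_two_mem {L : ℕ} [NeZero L] (hL : 2 ≤ L)
    (hρ : Continuous (ρ : G → Matrix (Fin N) (Fin N) ℂ)) (htr : ∀ g, (ρ g).trace.re ≤ N)
    {β s : ℝ} (hs : ∀ g, (N : ℝ) - (ρ g).trace.re ≤ s) (hβ : 0 ≤ β) :
    ((L ^ 2 - 1 : ℕ) : ℝ) * Real.log (z1 ρ β).toReal - β * s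
        ≤ Real.log (partitionFunction (d := 2) (L := L) ρ β).toReal ∧
      Real.log (partitionFunction (d := 2) (L := L) ρ β).toReal
        ≤ ((L ^ 2 - 1 : ℕ) : ℝ) * Real.log (z1 ρ β).toReal := by
  obtain ⟨hlo, hup, hz0, -⟩ := partitionFunction_two_toReal_mem ρ hL hρ htr hs hβ
  have hpow : 0 < (z1 ρ β).toReal ^ (L ^ 2 - 1) := pow_pos hz0 _
  have hZ0 : 0 < (partitionFunction (d := 2) (L := L) ρ β).toReal :=
    lt_of_lt_of_le (mul_pos (Real.exp_pos _) hpow) hlo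
  constructor
  · have h := Real.log_le_log (mul_pos (Real.exp_pos _) hpow) hlo
    rw [Real.log_mul (Real.exp_pos _).ne' hpow.ne', Real.log_exp, Real.log_pow] at h
    linarith
  · have h := Real.log_le_log hZ0 hup
    rwa [Real.log_pow] at h

/-- **THE FREE ENERGY DENSITY OF TWO-DIMENSIONAL LATTICE GAUGE THEORY IS `log z₁(β)`** — for every
compact second-countable group, every continuous representation with plaquette actions in `[0, s]`, and
every `β ≥ 0`: `log Z_{(ℤ/(L+2))²}(β) / (L+2)² → log z₁(β)` as `L → ∞`. -/
theorem tendsto_log_partitionFunction_two_div_sq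
    (hρ : Continuous (ρ : G → Matrix (Fin N) (Fin N) ℂ)) (htr : ∀ g, (ρ g).trace.re ≤ N)
    {β s : ℝ} (hs : ∀ g, (N : ℝ) - (ρ g).trace.re ≤ s) (hβ : 0 ≤ β) :
    Tendsto (fun L : ℕ =>
        Real.log (partitionFunction (d := 2) (L := L + 2) ρ β).toReal / ((((L + 2) ^ 2 : ℕ) : ℝ)))
      atTop (𝓝 (Real.log (z1 ρ β).toReal)) := by
  set f : ℝ := Real.log (z1 ρ β).toReal with hf
  have hs0 : 0 ≤ s := by
    have h1 := htr 1
    have h2 := hs 1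
    linarith
  have hC : Tendsto (fun L : ℕ => (|f| + β * s) / ((((L + 2) ^ 2 : ℕ) : ℝ))) atTop (𝓝 0) := by
    refine tendsto_const_nhds.div_atTop ?_
    have h : Tendsto (fun L : ℕ => (L + 2) ^ 2) atTop atTop := by
      refine tendsto_atTop_mono (fun L => ?_) tendsto_id
      simp only [id_eq]
      nlinarith
    exact tendsto_natCast_atTop_atTop.comp h
  rw [tendsto_iff_norm_sub_tendsto_zero]
  refine squeeze_zero (fun L => norm_nonneg _) (fun L => ?_) hC
  rw [Real.norm_eq_abs]
  haveI : NeZero (L + 2) := ⟨by omega⟩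
  obtain ⟨h0, h1⟩ := log_partitionFunction_two_mem ρ (L := L + 2) (by omega) hρ htr hs hβ
  have hV : (0 : ℝ) < (((L + 2) ^ 2 : ℕ) : ℝ) := by positivity
  have hV1 : ((((L + 2) ^ 2 - 1 : ℕ)) : ℝ) = (((L + 2) ^ 2 : ℕ) : ℝ) - 1 := by
    rw [Nat.cast_sub (Nat.one_le_pow _ _ (by omega)), Nat.cast_one]
  rw [hV1] at h0 h1
  have hkey : Real.log (partitionFunction (d := 2) (L := L + 2) ρ β).toReal
        / (((L + 2) ^ 2 : ℕ) : ℝ) - f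
      = (Real.log (partitionFunction (d := 2) (L := L + 2) ρ β).toReal
          - (((L + 2) ^ 2 : ℕ) : ℝ) * f) / (((L + 2) ^ 2 : ℕ) : ℝ) := by
    field_simp
  rw [hkey, abs_div, abs_of_pos hV, div_le_div_iff_of_pos_right hV]
  rw [abs_le]
  have hβs : 0 ≤ β * s := mul_nonneg hβ hs0
  constructor
  · nlinarith [le_abs_self f, neg_abs_le f]
  · nlinarith [le_abs_self f, neg_abs_le f]

end General

/-! ### 2. `SU(3)`: the sandwich and the density in Bessel–Toeplitz form (given Weyl's formula) -/

/-- `Re tr U ≤ 3` on `SU(3)` (fundamental representation). -/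
theorem su3_trace_re_le (g : Matrix.specialUnitaryGroup (Fin 3) ℂ) :
    ((fundamentalRep (Fin 3) g).trace).re ≤ (3 : ℕ) := by
  have h := CompactGroup.abs_re_trace_le_card (fundamentalRep (Fin 3))
    (continuous_fundamentalRep (Fin 3)) g
  rw [Fintype.card_fin] at h
  exact (abs_le.mp h).2

/-- The SU(3) plaquette action is at most `6`: `3 − Re tr U ≤ 6`. -/
theorem su3_plaqAction_le (g : Matrix.specialUnitaryGroup (Fin 3) ℂ) :
    ((3 : ℕ) : ℝ) - ((fundamentalRep (Fin 3) g).trace).re ≤ 6 := by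
  have h := CompactGroup.abs_re_trace_le_card (fundamentalRep (Fin 3))
    (continuous_fundamentalRep (Fin 3)) g
  rw [Fintype.card_fin] at h
  have := (abs_le.mp h).1
  push_cast at this ⊢
  linarith

/-- The Bessel–Toeplitz sum is positive: `Σ_q det[I_{|q+i−j|}(β)] = Z₃(3β)/(6(2π)²) > 0`. -/
theorem tsum_det_besselI_pos (β : ℝ) :
    0 < ∑' q : ℤ, (Matrix.of fun i j : Fin 3 => besselI (q + (i : ℕ) - (j : ℕ)).natAbs β).det := by
  have h := onePlaquetteZSU3_eq_tsum_det (3 * β)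
  rw [mul_div_cancel_left₀ β three_ne_zero] at h
  have hZ := onePlaquetteZSU3_pos (3 * β)
  rw [h] at hZ
  have h6 : (0 : ℝ) < 6 * (2 * π) ^ 2 := by positivity
  exact pos_of_mul_pos_right (by simpa [mul_assoc] using hZ) h6.le

/-- **theory-2's `z₁^{SU(3)}(β)` as a positive real** (given Weyl's formula):
`z₁(β).toReal = e^{−3β} Σ_q det[I_{|q+i−j|}(β)]`. -/
theorem z1_su3_toReal (hW : weylIntegralFormula_specialUnitary (Fin 3)) (β : ℝ) :
    (z1 (fundamentalRep (Fin 3)) β).toReal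
      = Real.exp (-(3 * β)) * ∑' q : ℤ,
          (Matrix.of fun i j : Fin 3 => besselI (q + (i : ℕ) - (j : ℕ)).natAbs β).det := by
  rw [z1_su3_eq_tsum_det hW, ENNReal.toReal_ofReal]
  exact mul_nonneg (Real.exp_pos _).le (tsum_det_besselI_pos β).le

/-- **THE 2-d SU(3) TORUS FREE ENERGY IN BESSEL FORM, UP TO ONE PLAQUETTE** (given Weyl's formula):
for `β ≥ 0`, `L ≥ 2`, with `F(β) = −3β + log Σ_q det[I_{|q+i−j|}(β)]`,
`(L² − 1) F(β) − 6β ≤ log Z^{SU(3)}_{(ℤ/L)²}(β) ≤ (L² − 1) F(β)`. -/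
theorem log_partitionFunction_su3_two_mem (hW : weylIntegralFormula_specialUnitary (Fin 3))
    {L : ℕ} [NeZero L] (hL : 2 ≤ L) {β : ℝ} (hβ : 0 ≤ β) :
    ((L ^ 2 - 1 : ℕ) : ℝ) * (-(3 * β) + Real.log (∑' q : ℤ,
        (Matrix.of fun i j : Fin 3 => besselI (q + (i : ℕ) - (j : ℕ)).natAbs β).det)) - β * 6
        ≤ Real.log (partitionFunction (d := 2) (L := L) (fundamentalRep (Fin 3)) β).toReal ∧
      Real.log (partitionFunction (d := 2) (L := L) (fundamentalRep (Fin 3)) β).toReal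
        ≤ ((L ^ 2 - 1 : ℕ) : ℝ) * (-(3 * β) + Real.log (∑' q : ℤ,
          (Matrix.of fun i j : Fin 3 => besselI (q + (i : ℕ) - (j : ℕ)).natAbs β).det)) := by
  have h := log_partitionFunction_two_mem (fundamentalRep (Fin 3)) hL
    (continuous_fundamentalRep (Fin 3)) su3_trace_re_le su3_plaqAction_le hβ
  have hlog : Real.log (z1 (fundamentalRep (Fin 3)) β).toReal
      = -(3 * β) + Real.log (∑' q : ℤ,
          (Matrix.of fun i j : Fin 3 => besselI (q + (i : ℕ) - (j : ℕ)).natAbs β).det) := by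
    rw [z1_su3_toReal hW, Real.log_mul (Real.exp_pos _).ne' (tsum_det_besselI_pos β).ne',
      Real.log_exp]
  rw [hlog] at h
  exact h

/-- **THE FREE ENERGY DENSITY OF 2-d SU(3) LATTICE YANG–MILLS** (given Weyl's formula): for `β ≥ 0`,
`log Z^{SU(3)}_{(ℤ/(L+2))²}(β) / (L+2)² → −3β + log Σ_{q ∈ ℤ} det[I_{|q+i−j|}(β)]_{i,j<3}` as `L → ∞`. -/
theorem tendsto_log_partitionFunction_su3_two_div_sq
    (hW : weylIntegralFormula_specialUnitary (Fin 3)) {β : ℝ} (hβ : 0 ≤ β) :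
    Tendsto (fun L : ℕ =>
        Real.log (partitionFunction (d := 2) (L := L + 2) (fundamentalRep (Fin 3)) β).toReal
          / ((((L + 2) ^ 2 : ℕ) : ℝ)))
      atTop (𝓝 (-(3 * β) + Real.log (∑' q : ℤ,
        (Matrix.of fun i j : Fin 3 => besselI (q + (i : ℕ) - (j : ℕ)).natAbs β).det))) := by
  have h := tendsto_log_partitionFunction_two_div_sq (fundamentalRep (Fin 3))
    (continuous_fundamentalRep (Fin 3)) su3_trace_re_le su3_plaqAction_le hβ
  rw [z1_su3_toReal hW, Real.log_mul (Real.exp_pos _).ne' (tsum_det_besselI_pos β).ne',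
    Real.log_exp] at h
  exact h

end Summit.Ventures.LatticeQCDFlow.Scoring
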